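import Summits.Ventures.HodgeRepro2.T7SupportTorusProjectorCharacter
import Summits.Ventures.HodgeRepro2.T7SupportBergmanOneVectorMonomialRegularPoint
import Summits.Ventures.HodgeRepro2.T7SupportDenseRegularProduct

/-!
# The three archimedean places with a CHARACTER at the compact place (support, seat p1)

The composite of row 709 with the memo's actual prescription at `ι₁` (L3-ARGUMENT §4a (b), t7-crit-1's Record B, STATUS
l. 15307): the compact-place component is a character `χ` of `G₁` on the line of `v₁`, so `Φ^{(1)}_{q₁}(γ₁) = χ(γ₁) ‖v₁‖²`
never vanishes and NO regularity condition is needed at `ι₁` (`T7SupportTorusProjectorCharacter`). With the rank-one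
places as in rows 704–706 (`u_A = z^{n_j}`, expansions `c_j` of `π_{k_j}(h_j⁻¹) z^{n_j}` as parameters, per-place `hq_v`:
`c_j(m_j) ≠ 0`), row 681's three-place lemma (with the empty exceptional set at `ι₁`) gives:

  **every dense `S ⊆ G₁ × SU(1,1) × SU(1,1)` contains a `γ₀` regular at `ι₂, ι₃` with all three one-vector Fourier
  coefficients — hence their product — non-zero** (`exists_mem_dense_regular_fourierCoeff_ne_zero₃_character`).

What stays in words: the dense `S` of rational points (WA′), the dictionary, and the continuity of the character on
the real group (here a hypothesis `hχ : Continuous χ`, automatic for a unitary character of a topological group).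

Nothing here is about any specific group, the adelic group, or any period.
Blind lane: Mathlib + the HodgeRepro2 prefix only; no sorry; axioms ⊆ {propext, Classical.choice, Quot.sound}.
-/

namespace Summit.Ventures.HodgeRepro2.T7SupportOneVectorArchimedeanCharacter

open MeasureTheory Metric
open scoped InnerProductSpace
open T5SU11Unimodular T5SU11Fibration T5BergmanCoefficient T5BergmanMatrixCoeff T5HaarCircle
  T7SupportTwoTorusInvariant T7SupportWeightTorusOrbital T7SupportOneVectorOrbital T7SupportTorusProjector
  T7SupportTorusProjectorCharacter T7SupportBergmanOneVectorMonomial T7SupportBergmanOneVectorMonomialRegularPoint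
  T7SupportDenseRegularProduct

variable {G₁ : Type*} [Group G₁] [TopologicalSpace G₁] {V₁ : Type*} [NormedAddCommGroup V₁] [InnerProductSpace ℂ V₁]
  [MeasurableSpace Circle] [BorelSpace Circle] [CompleteSpace V₁]

/-- **the compact-place Fourier coefficient of a character is continuous in `γ`** -/
theorem continuous_fourierCoeff_character {τ : G₁ →* (V₁ →ₗ[ℂ] V₁)} (hτ : IsUnitaryRep τ) {ρB : Circle →* G₁}
    {q : ℤ} {v : V₁} (hv : IsWeightVector τ ρB q v) {χ : G₁ → ℂ} (hχ : ∀ g, τ g v = χ g • v)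
    (hχc : Continuous χ) (h : G₁) :
    Continuous fun γ : G₁ => T7SupportOneVectorOrbital.fourierCoeff τ v h ρB q γ := by
  have e : (fun γ : G₁ => T7SupportOneVectorOrbital.fourierCoeff τ v h ρB q γ) =
      fun γ => χ γ * ((‖v‖ : ℝ) : ℂ) ^ 2 := funext fun γ => fourierCoeff_eq_of_character hτ hv hχ h γ
  rw [e]
  exact hχc.mul continuous_const

/-- **a regular point (at the rank-one places) of a dense subset of `G₁ × SU(1,1) × SU(1,1)` where all three one-vector
Fourier coefficients are non-zero** — the compact place a character (no condition there), the rank-one places with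
`u_A = z^{n_j}` and the per-place `hq`: `c_j(m_j) ≠ 0` -/
theorem exists_mem_dense_regular_fourierCoeff_ne_zero₃_character {τ : G₁ →* (V₁ →ₗ[ℂ] V₁)} (hτ : IsUnitaryRep τ)
    {ρB : Circle →* G₁} {q : ℤ} {v : V₁} (hv0 : v ≠ 0) (hv : IsWeightVector τ ρB q v) {χ : G₁ → ℂ}
    (hχ : ∀ g, τ g v = χ g • v) (hχc : Continuous χ) (h₁ : G₁)
    (k₂ : ℕ) (hk₂ : 2 ≤ k₂) (n₂ : ℕ) (h₂ : SU11) (c₂ : ℕ → ℂ)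
    (hc₂ : ∀ z ∈ ball (0 : ℂ) 1, HasSum (fun j => c₂ j * z ^ j) (act k₂ h₂⁻¹ (fun z => z ^ n₂) z)) (m₂ : ℕ)
    (hm₂ : c₂ m₂ ≠ 0)
    (k₃ : ℕ) (hk₃ : 2 ≤ k₃) (n₃ : ℕ) (h₃ : SU11) (c₃ : ℕ → ℂ)
    (hc₃ : ∀ z ∈ ball (0 : ℂ) 1, HasSum (fun j => c₃ j * z ^ j) (act k₃ h₃⁻¹ (fun z => z ^ n₃) z)) (m₃ : ℕ)
    (hm₃ : c₃ m₃ ≠ 0) {S : Set (G₁ × SU11 × SU11)} (hS : Dense S) :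
    ∃ γ₀ ∈ S,
      T7SupportOneVectorOrbital.fourierCoeff τ v h₁ ρB q γ₀.1 *
        monomialFourierCoeff k₂ n₂ h₂ (-((k₂ + 2 * m₂ : ℕ) : ℤ)) γ₀.2.1 *
        monomialFourierCoeff k₃ n₃ h₃ (-((k₃ + 2 * m₃ : ℕ) : ℤ)) γ₀.2.2 ≠ 0 ∧
      kappa (starRingEnd ℂ) T7SupportKappaCartan.dd (T7SupportKappaCartan.colBasis h₂) (mat γ₀.2.1) ≠ 1 ∧
      kappa (starRingEnd ℂ) T7SupportKappaCartan.dd (T7SupportKappaCartan.colBasis h₃) (mat γ₀.2.2) ≠ 1 := by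
  obtain ⟨s, hsS, h1, h2, h3, -, hZ2, hZ3⟩ := exists_mem_dense_prod₃_ne_zero_notMem hS
    (continuous_fourierCoeff_character hτ hv hχ hχc h₁) (continuous_monomialFourierCoeff k₂ hk₂ n₂ h₂ c₂ hc₂ m₂)
    (continuous_monomialFourierCoeff k₃ hk₃ n₃ h₃ c₃ hc₃ m₃)
    ⟨1, fourierCoeff_ne_zero_of_character hτ hv0 hv hχ h₁ 1⟩
    ⟨1, (monomialFourierCoeff_one_ne_zero_iff k₂ hk₂ n₂ h₂ c₂ hc₂ m₂).2 hm₂⟩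
    ⟨1, (monomialFourierCoeff_one_ne_zero_iff k₃ hk₃ n₃ h₃ c₃ hc₃ m₃).2 hm₃⟩
    (Z₁ := ∅) isClosed_empty interior_empty
    (T7SupportDenseRegularPoint.isClosed_kappa_eq_one h₂) (T7SupportDenseRegularPoint.interior_kappa_eq_one_eq_empty h₂)
    (T7SupportDenseRegularPoint.isClosed_kappa_eq_one h₃) (T7SupportDenseRegularPoint.interior_kappa_eq_one_eq_empty h₃)
  exact ⟨s, hsS, mul_ne_zero (mul_ne_zero h1 h2) h3, hZ2, hZ3⟩

end Summit.Ventures.HodgeRepro2.T7SupportOneVectorArchimedeanCharacter
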